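import Literature.AlgebraicGeometry.Frobenioids.DivisorMonoidCategoryTheoreticityCorSchemaNegativeB
import Literature.AlgebraicGeometry.Frobenioids.DivisorMonoidCategoryTheoreticityThm42SchemaNegative
import HarnessLib

/-!
# Frobenioids I, Corollary 4.11 (iv) and the compatibility clause of Corollary 4.11 (iii) AS TYPED over the
# data-only interfaces: the universal closures are false — kernel `¬ ∀` (FACT-LIST rows F-1029, F-1028;
# schema / R5)

Mochizuki, *The geometry of Frobenioids I: the general theory*, Kyushu J. Math. **62** (2008)
293–400, Cor. 4.11 (iii), (iv), kurims text p. 92 [cite: MochizukiFrdI2008, Cor. 4.11 (iv) p.92]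
[cite: MochizukiFrdI2008, Cor. 4.11 (iii) p.92].

PROOF-ONLY companion (no definitions, no instances) of the statement file
`DivisorMonoidCategoryTheoreticity.lean` (seat abc-iut-L1-t3), cell abc-iut, F fact-proving wave, seat
abc-iut-f-033, FACT-LIST rows **F-1029** `PreFrobenioidData.Cor411iv` and **F-1028**
`PreFrobenioidData.Cor411iii_compat` (class `preparatory`, kernel_closedness `parametrised`); sequel of seat
abc-iut-f-032's `DivisorMonoidCategoryTheoreticityCorSchemaNegative(B).lean` (rows F-1024 – F-1027), whose
degenerate operations and junk parameters are re-used BY NAME.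

* `not_forall_cor411iv` (F-1029) — the typed Cor. 4.11 (iv) quantifies over the data-only operations
  `S_i : PreFrobenioidData C_i D_i` (Def. 1.1 (iv), NOT the Frobenioid axioms of Def. 1.3) and over the
  data-only Def. 4.5 (iii) parameters `R_i : RSParams`; for f-032's degenerate operations on `B(N_{≥1})`
  over `Discrete PUnit` and `Discrete Bool` (identity `Ψ`; `CorSchemaNegative.exists_degenerate`,
  `cor411Setting_of_degenerate`) and junk "rationally standard" parameters (`CorSchemaNegative.exists_rsParams`)
  every typed hypothesis holds, but the conclusion posits an equivalence `Ψ^Base : Discrete PUnit ⥤ Discrete Bool`;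
* `not_forall_cor411iii_compat` (F-1028) — the typed compatibility clause quantifies over a BARE pair
  (`Ψ^Φ`-candidate `E`, family of prime bijections `e`); for the trivial operations with `Φ ≡ ℤ_{≥0} × ℤ_{≥0}`
  on the one-morphism category (isotropic, not group-like), `E = id` and `e =` the swap of the two primes
  (`ℤ_{≥0} × 0` and `0 × ℤ_{≥0}`, seat abc-iut-f-036's `DegreeModel.isPrimary_inl`), the clause fails at
  `(1, 0) ∈ Φ_{𝔭₁} \ Φ_{𝔭₂}`.

The forms print asserts and the tree PROVES are the instances AT THE CONSTRUCTIONS (cited, not restated):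
`PreFrobenioid.cor411iv_holds_of_isOfFSMType` / `FrdI.cor411iv_ofFunctor_of_isOfFSMType`
(`DivisorMonoidCategoryTheoreticityCor411ivHolds.lean`), `FrdI.T42.cor411iv_inst_of_setting` (seat
abc-iut-L1-t14); `PreFrobenioid.cor411iii_compat_holds_of_isOfFSMType` / `FrdI.exists_cor411iii_compat_of_isOfFSMType`
(`DivisorMonoidCategoryTheoreticityCor411iiiCompatHolds.lean`), `FrdI.T42.exists_cor411iii_compat_of_setting`.
So F-1029 / F-1028 are admissible AT NAMED INSTANCES ONLY. Bookkeeping about the typing; nothing here bears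
on [IUTchIII] Cor. 3.12 or takes a side; a refuted closure is a statement about the schema, not about the paper.
-/

namespace Literature.AlgebraicGeometry.Frobenioids

open CategoryTheory

namespace PreFrobenioidData

open CorSchemaNegative

/-! ### F-1029: the universal closure of `Cor411iv` is false -/

/-- **F-1029 (FACT-LIST), schema negative.** The universal closure of the typed Cor. 4.11 (iv)
`PreFrobenioidData.Cor411iv` — quantified over the data-only interfaces `PreFrobenioidData` and `RSParams` —
is false: for the degenerate operations on `B(N_{≥1})` over `Discrete PUnit` and `Discrete Bool` (identity
`Ψ`; seat abc-iut-f-032) the hypotheses `Cor411Setting` hold and the junk parameters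
`CorSchemaNegative.exists_rsParams` are "rationally standard", but the conclusion requires an equivalence
`Ψ^Base : Discrete PUnit ⥤ Discrete Bool`. The printed statement is the instance at THE constructions over
Frobenioids, PROVED in the tree (`PreFrobenioid.cor411iv_holds_of_isOfFSMType`,
`FrdI.cor411iv_ofFunctor_of_isOfFSMType`, seat abc-iut-f-033; `FrdI.T42.cor411iv_inst_of_setting`, seat
abc-iut-L1-t14). [cite: MochizukiFrdI2008, Cor. 4.11 (iv) p.92] -/
theorem not_forall_cor411iv :
    ¬ ∀ (C₁ : Type) [Category.{0} C₁] (D₁ : Type) [Category.{0} D₁]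
        (C₂ : Type) [Category.{0} C₂] (D₂ : Type) [Category.{0} D₂]
        (S₁ : PreFrobenioidData.{0} C₁ D₁) (S₂ : PreFrobenioidData.{0} C₂ D₂) (Ψ : C₁ ≌ C₂)
        (R₁ : RSParams.{0, 0, 0, 0, 0, 0} S₁) (R₂ : RSParams.{0, 0, 0, 0, 0, 0} S₂),
        S₁.Cor411iv S₂ Ψ R₁ R₂ := by
  intro h
  obtain ⟨S₁, hdeg₁, hdiv₁, hM₁, hpull₁⟩ := exists_degenerate (D := Discrete PUnit.{1}) ⟨⟨⟩⟩
  obtain ⟨S₂, hdeg₂, hdiv₂, hM₂, hpull₂⟩ := exists_degenerate (D := Discrete Bool) ⟨true⟩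
  have hst₁ := isOfStandardType S₁ hdeg₁ hdiv₁ (fun f => inferInstance) hM₁ hpull₁
  have hst₂ := isOfStandardType S₂ hdeg₂ hdiv₂ (fun f => inferInstance) hM₂ hpull₂
  obtain ⟨R₁, hR₁⟩ := exists_rsParams S₁ hdeg₁ hM₁ ⟨⟨⟩⟩ hst₁
  obtain ⟨R₂, hR₂⟩ := exists_rsParams S₂ hdeg₂ hM₂ ⟨true⟩ hst₂
  obtain ⟨ΨBase, -, -, hE, -⟩ := h _ _ _ _ S₁ S₂ CategoryTheory.Equivalence.refl R₁ R₂
    (cor411Setting_of_degenerate S₁ S₂ _ hdeg₁ hdiv₁ hM₁ hpull₁ (fun f => inferInstance)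
      (fun X Y => inferInstance) hdeg₂ hdiv₂ hM₂ hpull₂ (fun f => inferInstance) (fun X Y => inferInstance))
    hR₁ hR₂
  haveI := hE
  have e : PUnit.{1} ≃ Bool := Discrete.equivOfEquivalence ΨBase.asEquivalence
  exact absurd (e.symm.injective (Subsingleton.elim (e.symm true) (e.symm false))) (by decide)

/-! ### F-1028: the universal closure of `Cor411iii_compat` is false -/

/-- `(0, 1) ∉ (ℤ_{≥0} × ℤ_{≥0})_{𝔭₁}` for the prime `𝔭₁` of `(1, 0)`: the submonoid generated by the primary
elements `≼`-equivalent to `(1, 0)` lies in `ℤ_{≥0} × 0` (seat abc-iut-f-036's `DegreeModel.isPrimary_inl`,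
`DegreeModel.dvd_iff_le_N`). [cite: MochizukiFrdI2008, §0 p.12] -/
theorem inr_not_mem_primesSubmonoid_inl :
    ((1, Multiplicative.ofAdd 1) : DegreeModel.N × DegreeModel.N) ∉
      Primes.submonoid (Quotient.mk (primarySetoid (DegreeModel.N × DegreeModel.N))
        ⟨(Multiplicative.ofAdd 1, 1), DegreeModel.isPrimary_inl⟩) := by
  intro h
  -- the submonoid `ℤ_{≥0} × 0` (kernel of the second projection) contains the generating subset
  have hle : Primes.submonoid (Quotient.mk (primarySetoid (DegreeModel.N × DegreeModel.N))
        ⟨(Multiplicative.ofAdd 1, 1), DegreeModel.isPrimary_inl⟩) ≤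
      MonoidHom.mker (MonoidHom.snd DegreeModel.N DegreeModel.N) := by
    refine Submonoid.closure_le.mpr ?_
    rintro a ⟨ha, hcls⟩
    obtain ⟨n, -, hdvd⟩ : Precsim a ((Multiplicative.ofAdd 1, 1) : DegreeModel.N × DegreeModel.N) :=
      Quotient.exact hcls
    have h2 : a.2 ∣ (1 : DegreeModel.N) := by
      have := map_dvd (MonoidHom.snd DegreeModel.N DegreeModel.N) hdvd
      rwa [map_pow, MonoidHom.coe_snd, one_pow] at this
    rw [SetLike.mem_coe, MonoidHom.mem_mker, MonoidHom.coe_snd]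
    rw [DegreeModel.dvd_iff_le_N, toAdd_one, Nat.le_zero] at h2
    exact Multiplicative.toAdd.injective h2
  have h0 := hle h
  rw [MonoidHom.mem_mker, MonoidHom.coe_snd] at h0
  exact one_ne_zero (congrArg Multiplicative.toAdd h0 : (1 : ℕ) = 0)

/-- **F-1028 (FACT-LIST), schema negative.** The universal closure of the typed compatibility clause of
Cor. 4.11 (iii) `PreFrobenioidData.Cor411iii_compat` — quantified over the data-only operations and over a
BARE pair (`Ψ^Φ`-candidate `E`, family of prime bijections `e`) — is false: for the trivial operations with
`Φ ≡ ℤ_{≥0} × ℤ_{≥0}` (identity pull-backs, `Div = 0`, `deg_Fr = 1`) on the one-morphism category `Discrete PUnit`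
(of isotropic type — every arrow is invertible —, not of group-like type), `Ψ^Base = 𝟭`, `E = id` and `e` the
swap of the two primes `𝔭₁ = [(1,0)]`, `𝔭₂ = [(0,1)]`, the clause "`x ∈ Φ_𝔭 ⟺ E x ∈ Φ_{e 𝔭}`" fails at
`x = (1, 0)`, `𝔭 = 𝔭₁`. Print asserts the clause for THE `Ψ^Φ` of Thm. 4.9 and THE `Ψ^Prime` of Thm. 4.2 (ii),
an instance PROVED in the tree (`PreFrobenioid.cor411iii_compat_holds_of_isOfFSMType`,
`FrdI.exists_cor411iii_compat_of_isOfFSMType`, seat abc-iut-f-033; `FrdI.T42.exists_cor411iii_compat_of_setting`,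
seat abc-iut-L1-t14). [cite: MochizukiFrdI2008, Cor. 4.11 (iii) p.92] -/
theorem not_forall_cor411iii_compat :
    ¬ ∀ (C₁ : Type) [Category.{0} C₁] (D₁ : Type) [Category.{0} D₁]
        (C₂ : Type) [Category.{0} C₂] (D₂ : Type) [Category.{0} D₂]
        (S₁ : PreFrobenioidData.{0} C₁ D₁) (S₂ : PreFrobenioidData.{0} C₂ D₂) (ΨBase : D₁ ⥤ D₂)
        (E : DivisorMonoidIsoOverBase S₁ S₂ ΨBase)
        (e : ∀ X : D₁, Primes (S₁.Mon X) ≃ Primes (S₂.Mon (ΨBase.obj X))),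
        S₁.Cor411iii_compat S₂ E e := by
  intro h
  -- the trivial operations with `Φ ≡ ℤ_{≥0} × ℤ_{≥0}` on the one-morphism category
  let S : PreFrobenioidData.{0} (Discrete PUnit.{1}) (Discrete PUnit.{1}) :=
    { base := 𝟭 _
      Mon := fun _ => DegreeModel.N × DegreeModel.N
      pull := fun _ => MonoidHom.id _
      pull_id := fun _ _ => rfl
      pull_comp := fun _ _ _ => rfl
      div := fun _ => 1
      degFr := fun _ => 1
      div_id := fun _ => rfl
      div_comp := fun _ _ => by simp
      degFr_id := fun _ => rfl
      degFr_comp := fun _ _ => (mul_one 1).symm }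
  let E : DivisorMonoidIsoOverBase S S (𝟭 _) :=
    { iso := fun _ => MulEquiv.refl _
      natural := fun _ _ _ _ => rfl }
  let swap : DegreeModel.N × DegreeModel.N ≃* DegreeModel.N × DegreeModel.N := MulEquiv.prodComm
  have hiso : S.IsOfIsotropicType := ⟨fun A B φ _ => inferInstance⟩
  have hng : ¬ S.IsOfGroupLikeType := fun hg =>
    DegreeModel.isPrimary_inl.1 (hg.obj ⟨⟨⟩⟩ (Multiplicative.ofAdd 1, 1))
  let 𝔭₁ : Primes (DegreeModel.N × DegreeModel.N) :=
    Quotient.mk (primarySetoid _) ⟨(Multiplicative.ofAdd 1, 1), DegreeModel.isPrimary_inl⟩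
  have hmem : ((Multiplicative.ofAdd 1, 1) : DegreeModel.N × DegreeModel.N) ∈ 𝔭₁.submonoid :=
    Submonoid.subset_closure ⟨DegreeModel.isPrimary_inl, rfl⟩
  have key := (h _ _ _ _ S S (𝟭 _) E (fun _ => Primes.congr swap) hiso hiso hng hng ⟨⟨⟩⟩ 𝔭₁
    (Multiplicative.ofAdd 1, 1)).mp hmem
  -- `E = id`, and `x ∈ Φ_{swap 𝔭₁} ⟺ swap⁻¹ x ∈ Φ_{𝔭₁}` with `swap⁻¹ (1, 0) = (0, 1)`
  change ((Multiplicative.ofAdd 1, 1) : DegreeModel.N × DegreeModel.N) ∈ (Primes.congr swap 𝔭₁).submonoid at key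
  rw [Primes.mem_submonoid_congr_iff] at key
  exact inr_not_mem_primesSubmonoid_inl key

end PreFrobenioidData

end Literature.AlgebraicGeometry.Frobenioids
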